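import Literature.Geometry.Symplectic.SteinBall
import Literature.Geometry.Symplectic.SteinBoundaryContact
import HarnessLib

/-!
# The contact structure induced on `∂B⁴ = S³` by the standard Stein structure is the standard one

Sibling (proofs) file of `SteinBall.lean` (`steinStructureClosedBall : SteinStructure B⁴`, the
standard Stein structure `(J₀, ‖z‖²)` on the closed unit ball of `ℂ²`) and
`SteinBoundaryContact.lean` (complex tangencies `contactPlane`, contact form
`SteinStructure.contactForm = -d^ℂφ`, Kähler form `SteinStructure.kahlerForm = -dd^ℂφ`).
Sanity theorems pinning the conventions of the contact layer on the model, everything **proved**: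
read ambiently through the differential `Dι_x = closedBallCoeDeriv x` of the inclusion
`B⁴ ↪ ℝ⁴`,

* `apply_zero_eq_neg_inner_closedBallCoeDeriv` — at a boundary point `x` the `0`-th (radial,
  `1 - ‖w‖`) chart coordinate of `v ∈ T_xB⁴` is `-⟪x, Dι_x v⟫`;
* `mem_contactPlane_ballJ_iff` — **the complex tangencies `ξ_x` of `∂B⁴` are the standard contact
  planes of `S³ ⊂ ℂ²`**: `Dι_x ξ_x = {u | u ⊥ x, u ⊥ J₀ x} = T_xS³ ∩ J₀ T_xS³`;
* `contactForm_steinStructureClosedBall` — the contact form is `α_x = 2⟪J₀ x, Dι_x ·⟫`, four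
  times the standard contact form `λ₀ = ½ Σⱼ (xⱼ dyⱼ - yⱼ dxⱼ)` of `S³` (`λ₀(u) = ½⟪J₀ x, u⟫`),
  positive on the Reeb direction `J₀ x`;
* `kahlerForm_steinStructureClosedBall` — the Kähler form is `ω_x(u, v) = 4⟪J₀ Dι_x u, Dι_x v⟫`,
  four times the standard symplectic form `ω₀ = Σⱼ dxⱼ ∧ dyⱼ` of `ℂ²` (`ω₀(u, v) = ⟪J₀ u, v⟫`).

So the boundary orientation / "right-handed twist" conventions of `SteinBoundaryContact.lean`
(frame `(ċ, J ċ, R)` with `α(R) > 0`) are those of the standard tight contact `S³`.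

## References

* R. E. Gompf, *Handlebody construction of Stein surfaces*, Ann. of Math. 148 (1998), §1
  (the standard contact structure on `S³ = ∂B⁴`). [Gompf1998]
* K. Cieliebak, Ya. Eliashberg, *From Stein to Weinstein and back*, AMS Colloquium Publ. 59
  (2012), Ch. 2. [CieliebakEliashberg2012]
-/

noncomputable section

open scoped Manifold ContDiff Topology RealInnerProductSpace
open Set Function Metric

namespace Literature.Geometry.Symplectic

open Literature.Topology.FourManifolds

/-- **In the boundary chart the radial coordinate of a tangent vector is `-⟪x, Dι_x v⟫`**: at a
boundary point `x` (`‖x‖ = 1`), the `0`-th chart coordinate of `v ∈ T_xB⁴` — the coordinate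
`1 - ‖w‖` of the polar chart — is minus the radial component of its ambient representative
(compare `dφ_x v = 2⟪x, Dι_x v⟫`, `mfderiv_ballPhi_apply`, with `dφ_x v = -2 v₀` from
`φ = (1 - w₀)²` in the chart, `writtenInExtChartAt_ballHeight_of_norm_eq_one`). [folklore] -/
theorem apply_zero_eq_neg_inner_closedBallCoeDeriv {x : Metric.closedBall (0 : EuclideanSpace ℝ (Fin 4)) 1} (hx : ‖(x : EuclideanSpace ℝ (Fin 4))‖ = 1) (v : EuclideanSpace ℝ (Fin 4)) :
    v 0 = -⟪(x : EuclideanSpace ℝ (Fin 4)), closedBallCoeDeriv x v⟫ := by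
  -- `dφ_x v = -2 v 0`, replaying the boundary-chart computation of `ClosedBallHandles.lean`
  have hφ : ((mfderiv (𝓡∂ 4) 𝓘(ℝ, ℝ) ballPhi x : EuclideanSpace ℝ (Fin 4) →L[ℝ] ℝ) v) = -2 * v 0 := by
    rw [MDifferentiableAt.mfderiv (mdifferentiableAt_ballHeight 3 x)]
    set e : EuclideanSpace ℝ (Fin 4) := extChartAt (𝓡∂ 4) x x with he
    have he0 : e 0 = 0 := by
      rw [he, extChartAt, closedBall_chartAt_of_norm_eq_one hx, closedBallBoundaryChart_extend_apply_zero,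
        hx, sub_self]
    have h1 : HasFDerivAt (fun w : EuclideanSpace ℝ (Fin 4) => 1 - w 0)
        (0 - (EuclideanSpace.proj 0 : EuclideanSpace ℝ (Fin 4) →L[ℝ] ℝ)) e :=
      (hasFDerivAt_const (1 : ℝ) e).sub (EuclideanSpace.proj (𝕜 := ℝ) (0 : Fin 4)).hasFDerivAt
    have hr := h1.pow 2
    have hEq : writtenInExtChartAt (𝓡∂ 4) 𝓘(ℝ, ℝ) x ballPhi =ᶠ[𝓝[range (𝓡∂ 4)] e]
        fun w => (1 - w 0) ^ 2 := by
      have hopen : IsOpen {w : EuclideanSpace ℝ (Fin 4) | w 0 < 1} := isOpen_lt (by fun_prop) continuous_const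
      have hmem : e ∈ {w : EuclideanSpace ℝ (Fin 4) | w 0 < 1} := by
        simp only [mem_setOf_eq, he0]; exact zero_lt_one
      filter_upwards [mem_nhdsWithin_of_mem_nhds (hopen.mem_nhds hmem), self_mem_nhdsWithin]
        with w hw1 hwI
      have hw0 : 0 ≤ w 0 := by
        rw [range_modelWithCornersEuclideanHalfSpace] at hwI; exact hwI
      exact writtenInExtChartAt_ballHeight_of_norm_eq_one hx hw0 (le_of_lt hw1)
    have hpt : writtenInExtChartAt (𝓡∂ 4) 𝓘(ℝ, ℝ) x ballPhi e = (fun w : EuclideanSpace ℝ (Fin 4) => (1 - w 0) ^ 2) e :=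
      writtenInExtChartAt_ballHeight_of_norm_eq_one hx (le_of_eq he0.symm) (by rw [he0]; exact zero_le_one)
    have hproj : ∀ w : EuclideanSpace ℝ (Fin 4), (EuclideanSpace.proj (0 : Fin 4) : EuclideanSpace ℝ (Fin 4) →L[ℝ] ℝ) w = w 0 := fun w => rfl
    have hclean : HasFDerivAt (fun w : EuclideanSpace ℝ (Fin 4) => (1 - w 0) ^ 2)
        (-((2 : ℝ) • (EuclideanSpace.proj (0 : Fin 4) : EuclideanSpace ℝ (Fin 4) →L[ℝ] ℝ))) e := by
      refine hr.congr_fderiv ?_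
      ext w
      simp [he0, hproj, two_mul]
    have hderiv := hclean.hasFDerivWithinAt.congr_of_eventuallyEq hEq hpt
    rw [hderiv.fderivWithin ((𝓡∂ 4).uniqueDiffOn _ ⟨_, rfl⟩)]
    show (-((2 : ℝ) • (EuclideanSpace.proj (0 : Fin 4) : EuclideanSpace ℝ (Fin 4) →L[ℝ] ℝ))) v = -2 * v 0
    simp [hproj]
  have h2 : (2 : ℝ) * ⟪(x : EuclideanSpace ℝ (Fin 4)), closedBallCoeDeriv x v⟫ = -2 * v 0 :=
    (mfderiv_ballPhi_apply x v).symm.trans hφ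
  linarith

/-- **The complex tangencies of `∂B⁴` are the standard contact planes of `S³`**: at a boundary
point `x`, `v ∈ ξ_x` iff its ambient representative `u = Dι_x v` satisfies `u ⊥ x` (tangent to
`S³`) and `u ⊥ J₀ x` (i.e. `J₀ u` tangent to `S³` as well): `ξ = TS³ ∩ J₀ TS³`. [folklore] -/
theorem mem_contactPlane_ballJ_iff {x : Metric.closedBall (0 : EuclideanSpace ℝ (Fin 4)) 1} (hx : ‖(x : EuclideanSpace ℝ (Fin 4))‖ = 1) (v : EuclideanSpace ℝ (Fin 4)) :
    v ∈ contactPlane ballJ x ↔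
      ⟪(x : EuclideanSpace ℝ (Fin 4)), closedBallCoeDeriv x v⟫ = 0 ∧
        ⟪stdComplexStructure (x : EuclideanSpace ℝ (Fin 4)), closedBallCoeDeriv x v⟫ = 0 := by
  rw [mem_contactPlane_iff, apply_zero_eq_neg_inner_closedBallCoeDeriv hx,
    apply_zero_eq_neg_inner_closedBallCoeDeriv hx, closedBallCoeDeriv_ballJ,
    inner_stdComplexStructure_right, neg_neg, neg_eq_zero]

/-- The same for the Stein structure `steinStructureClosedBall` (whose `J` is `ballJ`). [folklore] -/
theorem mem_contactPlane_steinStructureClosedBall_iff {x : Metric.closedBall (0 : EuclideanSpace ℝ (Fin 4)) 1} (hx : ‖(x : EuclideanSpace ℝ (Fin 4))‖ = 1) (v : EuclideanSpace ℝ (Fin 4)) :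
    v ∈ contactPlane steinStructureClosedBall.J x ↔
      ⟪(x : EuclideanSpace ℝ (Fin 4)), closedBallCoeDeriv x v⟫ = 0 ∧
        ⟪stdComplexStructure (x : EuclideanSpace ℝ (Fin 4)), closedBallCoeDeriv x v⟫ = 0 :=
  mem_contactPlane_ballJ_iff hx v

/-- **The contact form of the standard Stein structure is `α_x = 2⟪J₀ x, Dι_x ·⟫`** (at every
point; on `∂B⁴` this is four times the standard contact form `λ₀ = ½ Σⱼ (xⱼ dyⱼ - yⱼ dxⱼ)` of
`S³`, and `α(Dι⁻¹ (J₀ x)) = 2 > 0`: the Reeb direction `J₀ x` is positively transverse).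
[folklore] -/
theorem contactForm_steinStructureClosedBall (x : Metric.closedBall (0 : EuclideanSpace ℝ (Fin 4)) 1) (v : EuclideanSpace ℝ (Fin 4)) :
    steinStructureClosedBall.contactForm x v =
      2 * ⟪stdComplexStructure (x : EuclideanSpace ℝ (Fin 4)), closedBallCoeDeriv x v⟫ := by
  have h : steinStructureClosedBall.dφ x (ballJ x v) =
      (2 : ℝ) * ⟪(x : EuclideanSpace ℝ (Fin 4)), stdComplexStructure (closedBallCoeDeriv x v)⟫ := by
    have h0 : steinStructureClosedBall.dφ x (ballJ x v) =
        (2 : ℝ) * ⟪(x : EuclideanSpace ℝ (Fin 4)), closedBallCoeDeriv x (ballJ x v)⟫ := mfderiv_ballPhi_apply x (ballJ x v)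
    rw [closedBallCoeDeriv_ballJ] at h0
    exact h0
  have e1 : steinStructureClosedBall.contactForm x v = -(steinStructureClosedBall.dφ x (ballJ x v)) :=
    SteinStructure.contactForm_apply _ x v
  rw [e1, h, inner_stdComplexStructure_right, mul_neg, neg_neg]

/-- In particular the contact form is positive on the Reeb direction `Dι_x⁻¹ (J₀ x)` at a
boundary point: `α = 2 ‖x‖² = 2`. [folklore] -/
theorem contactForm_steinStructureClosedBall_reeb {x : Metric.closedBall (0 : EuclideanSpace ℝ (Fin 4)) 1} (hx : ‖(x : EuclideanSpace ℝ (Fin 4))‖ = 1) :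
    steinStructureClosedBall.contactForm x ((closedBallCoeDeriv x).symm (stdComplexStructure (x : EuclideanSpace ℝ (Fin 4)))) = 2 := by
  rw [contactForm_steinStructureClosedBall, ContinuousLinearEquiv.apply_symm_apply,
    inner_stdComplexStructure_stdComplexStructure, real_inner_self_eq_norm_sq, hx]
  norm_num

/-- **The Kähler form of the standard Stein structure is `ω_x(u, v) = 4⟪J₀ Dι_x u, Dι_x v⟫`**
(four times the standard symplectic form `ω₀ = Σⱼ dxⱼ ∧ dyⱼ` of `ℂ²`, for which
`ω₀(u, v) = ⟪J₀ u, v⟫`). [folklore] -/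
theorem kahlerForm_steinStructureClosedBall (x : Metric.closedBall (0 : EuclideanSpace ℝ (Fin 4)) 1) (u v : EuclideanSpace ℝ (Fin 4)) :
    steinStructureClosedBall.kahlerForm x u v =
      4 * ⟪stdComplexStructure (closedBallCoeDeriv x u), closedBallCoeDeriv x v⟫ := by
  rw [SteinStructure.kahlerForm, steinStructureClosedBall_J, steinStructureClosedBall_φ,
    mextDeriv_dComplex_ballJ_ballPhi]
  change -(extDeriv ambAlpha (x : EuclideanSpace ℝ (Fin 4)) ((closedBallCoeDeriv x : EuclideanSpace ℝ (Fin 4) →L[ℝ] EuclideanSpace ℝ (Fin 4)) ∘ ![u, v])) = _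
  have h : ((closedBallCoeDeriv x : EuclideanSpace ℝ (Fin 4) →L[ℝ] EuclideanSpace ℝ (Fin 4)) ∘ ![u, v]) =
      ![closedBallCoeDeriv x u, closedBallCoeDeriv x v] := by
    funext i; fin_cases i <;> rfl
  rw [h, extDeriv_ambAlpha_apply, inner_stdComplexStructure_right]
  ring

end Literature.Geometry.Symplectic

end
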